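import Literature.Computability.Cryptography.TreeSigExperiment
import HarnessLib

/-!
# The authentication-tree scheme, VIII: a forgery of the tree scheme contains a one-time forgery at a touched node

Topic `Literature/Computability/Cryptography`; the combinatorial heart of Goldreich's proof of Prop. 6.4.15 (Step 4,
"Using the output of `A'`", PDF pp. 244–247; inherited by Prop. 6.4.17), for the random-leaf variant `TreeSig.scheme`
and in the exact form the one-time forger of the reduction needs. Fix a level `n`, a block assignment
`Tab : label ↦ block` (the node keys are `pkOf (Tab L)`; in the reduction, the lazily sampled table), leaves `ρ` (the
`i`-th document is signed at `blk n i ρ`) and the forger's coins; the attack is `ForgeWith` against the signer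
`OFun Tab ρ i α = sigG Tab α (blk n i ρ)` with root key `pkOf (Tab ε)`. If the forger outputs `(α, sig)` accepted by
`V'` with `α` never queried, walk down the claimed authentication path `σ = fstF sig`: at the node `L = σ|_lvl`
(TOUCHED: the root, or a child of a node on some query path, so its key was generated during the attack) holding the
key `pkOf (Tab L)`, either some query path passes through `L` and the claimed pair of children keys is the pair `L`
actually signed — then the next key is the genuine key of the child `σ|_{lvl+1}`, again touched — or NOT, and then the
level's one-time signature is a forgery at `L`: valid under `pkOf (Tab L)` on a message `L` never signed (an internal
node signs only its children's pair; a leaf `L` signs only the documents `αᵢ` of the queries `i` with `blk n i ρ = L`,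
and `α` is none of them). Contents:

* `dropItems`, `compAt` — the component of a signature at a level (the pair of claimed keys and its one-time
  signature; at the leaf level the document and its signature), as string functions of `(α, items)`;
* `Touched`, `SignedMsgs` — touched labels and the messages signed at a label during the attack;
* **`TreeSig.exists_oneTime_forgeryI`** (node-interface form `OFunI pkN sgN`, the form the hybrid attacks of the
  reduction need) and `exists_oneTime_forgery_of_forgeWith` (`OFun Tab`) — from the forgery event: a level `lvl ≤ n`
  such that `L = σ|_lvl` is touched and `compAt lvl` is a valid one-time signature under the key of `L` on a message
  not in `SignedMsgs L`.

All statements proved; no named facts; no probability.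

## References

* O. Goldreich, *Foundations of Cryptography II: Basic Applications*, CUP 2004, §6.4.2.2, proof of Prop. 6.4.15,
  Step 4 (cases (a) `i = n` and (b) `i < n`), and §6.4.2.3 (Prop. 6.4.17: "the proof of Proposition 6.4.15 is
  oblivious of" how the node instances are generated).
* R. C. Merkle, *A certified digital signature*, CRYPTO '89, LNCS 435 (1990).
-/

namespace Literature.Computability.Cryptography

open _root_.Computability Complexity Complexity.Brick Polynomial

namespace TreeSig

variable (P : Spec)

/-! ### Components of a signature -/

/-- The items of a signature after the first `k` levels (three items per level). [folklore] -/
def dropItems (k : ℕ) (its : List Bool) : List Bool := (sndPow 2)^[k] its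

/-- `dropItems 0 = id`. [folklore] -/
@[simp] theorem dropItems_zero (its : List Bool) : dropItems 0 its = its := rfl

/-- One more level. [folklore] -/
theorem dropItems_succ (k : ℕ) (its : List Bool) : dropItems (k + 1) its = sndPow 2 (dropItems k its) := by
  rw [dropItems, dropItems, Function.iterate_succ_apply']

/-- The component of a signature `(α, items)` at level `lvl`: the claimed pair of children keys and its one-time
signature for `lvl < n`, the document and the leaf signature for `lvl = n`. [Goldreich 2004, Construction 6.4.14
(`V'`); proof of Prop. 6.4.15, Step 4] [folklore] -/
def compAt (n : ℕ) (α its : List Bool) (lvl : ℕ) : List Bool × List Bool :=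
  if lvl < n then (boolPair (nthF 0 (dropItems lvl its)) (nthF 1 (dropItems lvl its)), nthF 2 (dropItems lvl its))
  else (α, nthF 0 (dropItems lvl its))

/-! ### The function-table signer, touched labels, signed messages -/

/-- The signer over a NODE INTERFACE (`pkN` the node keys, `sgN` the node signers) with leaves `ρ`: the `i`-th document
at the leaf `blk n i ρ`. [Goldreich 2004, proofs of Prop. 6.4.15 / 6.4.17] [folklore] -/
def OFunI (n : ℕ) (pkN : List Bool → List Bool) (sgN : List Bool → List Bool → List Bool) (ρ : List Bool) : ℕ → List Bool → List Bool :=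
  fun i α => sigGI pkN sgN α (Yao.blk n i ρ)

/-- The signer over the block assignment `Tab` with leaves `ρ`: the `i`-th document at the leaf `blk n i ρ`.
[Goldreich 2004, proofs of Prop. 6.4.15 / 6.4.17] [folklore] -/
def OFun (n : ℕ) (Tab : List Bool → List Bool) (ρ : List Bool) : ℕ → List Bool → List Bool := fun i α => sigG P n Tab α (Yao.blk n i ρ)

/-- `OFun` is `OFunI` of the node functions of the table. [folklore] -/
theorem OFun_eq_OFunI (n : ℕ) (Tab : List Bool → List Bool) (ρ : List Bool) :
    OFun P n Tab ρ = OFunI n (fun L => pkOf P n (Tab L)) (fun L m => signOf P n (Tab L) m) ρ := rfl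

/-- A label is TOUCHED by the first `Q` queries: the root, or a child of a node on one of the query paths (its key was
generated during the attack). [Goldreich 2004, proof of Prop. 6.4.15 (the instances created by the signing process)] [folklore] -/
def Touched (n Q : ℕ) (ρ : List Bool) (L : List Bool) : Prop := L = [] ∨ ∃ i < Q, L ∈ pathLabels (Yao.blk n i ρ)

/-- The messages signed at the node `L` during the first `Q` queries `qs`: the pair of its children's keys if some query
path passes through the internal node `L`, and the documents of the queries whose leaf is `L`.
[Goldreich 2004, proof of Prop. 6.4.15, Step 4 ("the record of `A`")] [folklore] -/
def SignedMsgs (n : ℕ) (pkN : List Bool → List Bool) (ρ : List Bool) (qs : List (List Bool)) (L m : List Bool) : Prop :=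
  (L.length < n ∧ (∃ i < qs.length, (Yao.blk n i ρ).take L.length = L) ∧ m = boolPair (pkN (L ++ [false])) (pkN (L ++ [true]))) ∨
    ∃ (i : ℕ) (hi : i < qs.length), Yao.blk n i ρ = L ∧ m = qs[i]

variable {P}

/-! ### The walk down the claimed path -/

/-- Children of a node on a path are on the path's label list. [folklore] -/
theorem take_append_mem_pathLabels (σ : List Bool) {j : ℕ} (hj : j < σ.length) (c : Bool) : σ.take j ++ [c] ∈ pathLabels σ := by
  have ht : 2 * j + (if c then 1 else 0) < (pathLabels σ).length := by rw [length_pathLabels]; split <;> omega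
  have h := getElem_pathLabels' σ _ ht
  have hdiv : (2 * j + (if c then 1 else 0)) / 2 = j := by split <;> omega
  have hmod : decide ((2 * j + (if c then 1 else 0)) % 2 = 1) = c := by cases c <;> simp
  rw [hdiv, hmod] at h
  rw [← h]; exact List.getElem_mem _
where
  /-- entries of `pathLabels` (local copy of the lemma of `TreeSigDistinguisher.lean`, not imported here) -/
  getElem_pathLabels' (σ : List Bool) (t : ℕ) (ht : t < (pathLabels σ).length) : (pathLabels σ)[t] = σ.take (t / 2) ++ [decide (t % 2 = 1)] := by
    have key : ∀ (pre σ : List Bool) (t : ℕ) (ht : t < (pathLabelsFrom pre σ).length),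
        (pathLabelsFrom pre σ)[t] = pre ++ σ.take (t / 2) ++ [decide (t % 2 = 1)] := by
      intro pre σ
      induction σ generalizing pre with
      | nil => intro t ht; simp [pathLabelsFrom] at ht
      | cons b σ ih =>
        intro t ht
        match t, ht with
        | 0, _ => simp [pathLabelsFrom]
        | 1, _ => simp [pathLabelsFrom]
        | t + 2, ht =>
          have ht' : t < (pathLabelsFrom (pre ++ [b]) σ).length := by simp only [pathLabelsFrom, List.length_cons] at ht; omega
          simp only [pathLabelsFrom, List.getElem_cons_succ]
          rw [ih (pre ++ [b]) t ht']
          have h2 : (t + 2) / 2 = t / 2 + 1 := by omega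
          rw [h2, List.take_succ_cons, Nat.add_mod_right]
          simp
    simp only [pathLabels] at ht ⊢
    simpa using key [] σ t ht

/-- **The walk down the claimed path.** Along the remaining claimed bits `rest` from the touched node `L = σ ↾ |L|` holding the key
`pkOf (Tab L)`, an accepting `checkChain` yields a touched node with a valid one-time signature on a fresh message.
[Goldreich 2004, proof of Prop. 6.4.15, Step 4] [folklore] -/
theorem pathWalk {n : ℕ} (pkN : List Bool → List Bool) (ρ : List Bool) (qs : List (List Bool)) (α σ its : List Bool) (hσ : σ.length = n)
    (hα : α ∉ qs) (hρ : ∀ i < qs.length, (Yao.blk n i ρ).length = n) :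
    ∀ (rest L : List Bool), L ++ rest = σ → Touched n qs.length ρ L →
      checkChain P α (pkN L) rest (dropItems L.length its) = true →
      ∃ lvl ≤ n, Touched n qs.length ρ (σ.take lvl) ∧
        P.S.verify (pkN (σ.take lvl)) (compAt n α its lvl).1 (compAt n α its lvl).2 = true ∧
        ∀ m, SignedMsgs n pkN ρ qs (σ.take lvl) m → m ≠ (compAt n α its lvl).1
  | [], L, hL, hT, hc => by
    rw [List.append_nil] at hL
    subst hL
    refine ⟨L.length, hσ.le, by rwa [List.take_length], ?_, ?_⟩
    · rw [List.take_length, compAt, if_neg (by omega)]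
      rw [checkChain] at hc
      exact hc
    · intro m hm
      rw [List.take_length] at hm
      rw [compAt, if_neg (by omega)]
      rcases hm with ⟨hlt, -, -⟩ | ⟨i, hi, -, rfl⟩
      · omega
      · intro h
        have hm : qs[i] = α := h
        exact hα (hm ▸ List.getElem_mem hi)
  | b :: rest, L, hL, hT, hc => by
    classical
    have hlen : L.length < n := by rw [← hσ, ← hL]; simp
    rw [checkChain, Bool.and_eq_true] at hc
    obtain ⟨hv, hc'⟩ := hc
    rw [← dropItems_succ] at hc'
    by_cases hgo : (∃ i < qs.length, (Yao.blk n i ρ).take L.length = L) ∧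
        boolPair (nthF 0 (dropItems L.length its)) (nthF 1 (dropItems L.length its)) = boolPair (pkN (L ++ [false])) (pkN (L ++ [true]))
    · -- the level is authentic and the node was signing: descend to the child on the claimed path
      obtain ⟨⟨i, hi, htake⟩, hpair⟩ := hgo
      have hinj := (boolPair_injective_pair hpair)
      have hkey : (if b then nthF 1 (dropItems L.length its) else nthF 0 (dropItems L.length its)) = pkN (L ++ [b]) := by
        cases b
        · rw [if_neg Bool.false_ne_true, hinj.1]
        · rw [if_pos rfl, hinj.2]
      rw [hkey] at hc'
      have hT' : Touched n qs.length ρ (L ++ [b]) := by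
        refine Or.inr ⟨i, hi, ?_⟩
        rw [← htake]
        exact take_append_mem_pathLabels _ (by rw [hρ i hi]; exact hlen) b
      exact pathWalk pkN ρ qs α σ its hσ hα hρ rest (L ++ [b]) (by rw [List.append_assoc, List.singleton_append]; exact hL) hT'
        (by rw [List.length_append, List.length_singleton]; exact hc')
    · -- a one-time forgery at `L`
      have htake : σ.take L.length = L := by rw [← hL]; simp
      refine ⟨L.length, hlen.le, by rwa [htake], ?_, ?_⟩
      · rw [htake, compAt, if_pos hlen]
        exact hv
      · intro m hm
        rw [htake] at hm
        rw [compAt, if_pos hlen]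
        rcases hm with ⟨-, hex, rfl⟩ | ⟨i, hi, hleaf, -⟩
        · intro h
          exact hgo ⟨hex, h.symm⟩
        · have := hρ i hi
          rw [hleaf] at this
          omega
where
  /-- `boolPair` is injective in both fields -/
  boolPair_injective_pair {a₁ a₂ c₁ c₂ : List Bool} (h : boolPair a₁ c₁ = boolPair a₂ c₂) : a₁ = a₂ ∧ c₁ = c₂ := by
    have h1 := congrArg fstF h
    have h2 := congrArg sndF h
    simp only [fstF_boolPair, sndF_boolPair] at h1 h2
    exact ⟨h1, h2⟩

/-- **A forgery of the tree scheme contains a one-time forgery at a touched node** (node-interface form). From the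
forgery event of the indexed attack against the signer over `(pkN, sgN)` (root key `pkN ε`), with the forger's output
`(α, sig)` and its queries `qs`: there is a level `lvl ≤ n` such that the node `σ ↾ lvl` of the claimed path
`σ = fstF sig` is touched and the level's component is a valid one-time signature under that node's key on a message
the node never signed. [Goldreich 2004, proof of Prop. 6.4.15, Step 4 (cases (a), (b)); Prop. 6.4.17]
[cite: Goldreich2004, Prop. 6.4.15] -/
theorem exists_oneTime_forgeryI (𝒜 : OracleAdversary (List Bool × List Bool)) {n : ℕ} (pkN : List Bool → List Bool)
    (sgN : List Bool → List Bool → List Bool) (ρ r : List Bool) (hρ : TA P 𝒜 n * n ≤ ρ.length) {α sig : List Bool}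
    (hver : verifyT P (pkT P n (pkN [])) α sig = true)
    (hfresh : α ∉ 𝒜.alg.queriesIdx (OFunI n pkN sgN ρ) (TA P 𝒜 n) (boolPair (xA P n (pkN [])) r)) :
    (fstF sig).length = n ∧
    ∃ lvl ≤ n, Touched n (𝒜.alg.queriesIdx (OFunI n pkN sgN ρ) (TA P 𝒜 n) (boolPair (xA P n (pkN [])) r)).length ρ ((fstF sig).take lvl) ∧
      P.S.verify (pkN ((fstF sig).take lvl)) (compAt n α (sndF sig) lvl).1 (compAt n α (sndF sig) lvl).2 = true ∧
      ∀ m, SignedMsgs n pkN ρ (𝒜.alg.queriesIdx (OFunI n pkN sgN ρ) (TA P 𝒜 n) (boolPair (xA P n (pkN [])) r)) ((fstF sig).take lvl) m →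
        m ≠ (compAt n α (sndF sig) lvl).1 := by
  set qs := 𝒜.alg.queriesIdx (OFunI n pkN sgN ρ) (TA P 𝒜 n) (boolPair (xA P n (pkN [])) r) with hqs
  have hQ : qs.length ≤ TA P 𝒜 n := OracleAlg.length_queriesIdx_le _ _ _ _
  rw [verifyT, pkT, fstF_boolPair, sndF_boolPair, fstF_padPk, List.length_replicate, Bool.and_eq_true, decide_eq_true_eq] at hver
  obtain ⟨hσ, hc⟩ := hver
  have hblk : ∀ i < qs.length, (Yao.blk n i ρ).length = n := fun i hi =>
    Yao.length_blk_of_le (le_trans (Nat.mul_le_mul_right n (Nat.succ_le_of_lt (lt_of_lt_of_le hi hQ))) hρ)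
  exact ⟨hσ, pathWalk pkN ρ qs α (fstF sig) (sndF sig) hσ hfresh hblk (fstF sig) [] (List.nil_append _) (Or.inl rfl) hc⟩

/-- The same from `ForgeWith` (node-interface form). [Goldreich 2004, proof of Prop. 6.4.15, Step 4] [cite: Goldreich2004, Prop. 6.4.15] -/
theorem exists_oneTime_forgeryI_of_forgeWith (𝒜 : OracleAdversary (List Bool × List Bool)) {n : ℕ} (pkN : List Bool → List Bool)
    (sgN : List Bool → List Bool → List Bool) (ρ r : List Bool) (hρ : TA P 𝒜 n * n ≤ ρ.length) (h : ForgeWith P 𝒜 n (pkN []) (OFunI n pkN sgN ρ) r) :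
    ∃ α sig, 𝒜.alg.runIdx (OFunI n pkN sgN ρ) (TA P 𝒜 n) (boolPair (xA P n (pkN [])) r) = some (α, sig) ∧ (fstF sig).length = n ∧
      ∃ lvl ≤ n, Touched n (𝒜.alg.queriesIdx (OFunI n pkN sgN ρ) (TA P 𝒜 n) (boolPair (xA P n (pkN [])) r)).length ρ ((fstF sig).take lvl) ∧
        P.S.verify (pkN ((fstF sig).take lvl)) (compAt n α (sndF sig) lvl).1 (compAt n α (sndF sig) lvl).2 = true ∧
        ∀ m, SignedMsgs n pkN ρ (𝒜.alg.queriesIdx (OFunI n pkN sgN ρ) (TA P 𝒜 n) (boolPair (xA P n (pkN [])) r)) ((fstF sig).take lvl) m →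
          m ≠ (compAt n α (sndF sig) lvl).1 := by
  obtain ⟨α, sig, hout, hver, hfresh⟩ := (forgeWith_iff P 𝒜 n _ _ r).1 h
  exact ⟨α, sig, hout, exists_oneTime_forgeryI 𝒜 pkN sgN ρ r hρ hver hfresh⟩

/-- **A forgery of the tree scheme contains a one-time forgery at a touched node** (block-table form, `OFun`).
[Goldreich 2004, proof of Prop. 6.4.15, Step 4] [cite: Goldreich2004, Prop. 6.4.15] -/
theorem exists_oneTime_forgery_of_forgeWith (𝒜 : OracleAdversary (List Bool × List Bool)) {n : ℕ} (Tab : List Bool → List Bool) (ρ r : List Bool)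
    (hρ : TA P 𝒜 n * n ≤ ρ.length) (h : ForgeWith P 𝒜 n (pkOf P n (Tab [])) (OFun P n Tab ρ) r) :
    ∃ α sig, 𝒜.alg.runIdx (OFun P n Tab ρ) (TA P 𝒜 n) (boolPair (xA P n (pkOf P n (Tab []))) r) = some (α, sig) ∧ (fstF sig).length = n ∧
      ∃ lvl ≤ n, Touched n (𝒜.alg.queriesIdx (OFun P n Tab ρ) (TA P 𝒜 n) (boolPair (xA P n (pkOf P n (Tab []))) r)).length ρ ((fstF sig).take lvl) ∧
        P.S.verify (pkOf P n (Tab ((fstF sig).take lvl))) (compAt n α (sndF sig) lvl).1 (compAt n α (sndF sig) lvl).2 = true ∧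
        ∀ m, SignedMsgs n (fun L => pkOf P n (Tab L)) ρ (𝒜.alg.queriesIdx (OFun P n Tab ρ) (TA P 𝒜 n) (boolPair (xA P n (pkOf P n (Tab []))) r))
          ((fstF sig).take lvl) m → m ≠ (compAt n α (sndF sig) lvl).1 :=
  exists_oneTime_forgeryI_of_forgeWith 𝒜 (fun L => pkOf P n (Tab L)) (fun L m => signOf P n (Tab L) m) ρ r hρ h

end TreeSig

end Literature.Computability.Cryptography
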